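import Literature.MathematicalPhysics.QuantumFieldTheory.Balaban1983to89.B8Prop3MultiLevelTorusP26L3
import Literature.MathematicalPhysics.QuantumFieldTheory.Balaban1983to89.B8Thm4MultiLevelTorus
import Literature.MathematicalPhysics.QuantumFieldTheory.Balaban1983to89.B8Ineq192MultiLevelTorusL0
import Summits.QuantumFields.YangMills.Theorems.UnitScaleTiltProp8FlatPortKernelRowsAllL
import Summits.QuantumFields.YangMills.Theorems.UnitScaleTiltProp8FlatPortHRows12L0
import HarnessLib

/-!
# Route `UnitScaleTilt`, crux K1 child «MinimiserStabilityRegPr» (stmt-QuantumFields-19200), line H `BirthV10.stub_halvingStep` —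
# T2♭-PLAN brick **B3** (LEAD-H RULING L-2 (3)): THE LINEAR LANDAU THEOREM 4♭ ON THE LEVEL-0-ADMITTING `k`-LEVEL V1 TORUS AT EVERY ODD
# `L ≥ 3`, AND ITS `Adm22` ∕ `IsLevWeight` READING FOR THE H-LINE's CUBE SEQUENCES — lit r05's ✓ `B8Thm4MultiLevelTorus.thm4_multiLevelTorus_V1`
# (slice ∃! + Prop. 3♭ bounds) re-run on the L0 carriers with ym-inputs-p06 g2's floor-free producer ✓ `prop3_multiLevelTorus_V1_P26_vector_L3`,
# then ported `domT → _of_adm22` exactly as T3 ✓ `FlatPortKernelRowsAllL.kernelRowsAt_of_adm22_allL`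

Cell `ym3-torus` (HUMAN RULING D-0037, YM ladder rung R3), width seat `ym-ust-19936-w2` gen 5 on loan to line H; LEAD-H ★w5-19200 g4's T2♭-PLAN v1.1
(`T2FLAT-PLAN-v1.1-addendum-w5g4.md` 475b767a8a928ba2) and RULING L-2 (3) (bus 2026-08-28T10:15:25Z): «v1.0's B3 is COMPLETE modulo a port: the `cubeSeqMT3`∕`IsLevWeight`
READING of `thm4_multiLevelTorus_V1` — the J4c solver's linear core AND `core`'s (iii) gradient member at the fixed point».  `--supports stmt-QuantumFields-19200 --as helper`;
count-neutral; def-free.  Nothing of the stub, the crux, or [Balaban1985RegularSpaces] Thm 2 at a curved background is claimed.  Honest frame: YM₃ on the three-torus is rung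
R3 of the programme (finite-torus SU(2)), NOT the Clay problem; nothing here bears on d = 4, the continuum, or a mass gap.

WHAT.  r05's Theorem 4♭ (`thm4_multiLevelTorus_V1`) lives on the `Ω₁ = T_η` carriers `B6MultiLevelTorusOperator.TDomains` ∕ `B6GlobalChartV1.domT` and carries the block-size
floor `4 ≤ ℓ` (`L ≥ 5`) of its producer; the H-line's cube sequences `cubeSeqMT3` have a LEVEL-0 ANNULUS (`Λ₀ = □₀ ∖ □₁ ≠ ∅`) and quantify every odd `L > 1`, and are realised
as `B6GlobalChartV1L0.domT hN D hk` of a LEVEL-0-ADMITTING family `D : B6MultiLevelTorusOperatorL0.TDomains` by ✓ `FlatPortChartL0.tdOfAdmL0`∕`domT_tdOfAdmL0` (the T1–T4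
`_allL` chain).  THIS FILE:
* §1 ★★ `thm4_multiLevelTorus_V1_L3` — THEOREM 4 AT `U₀ = 1` ON THE LEVEL-0-ADMITTING `k`-LEVEL V1 TORUS, EVERY ODD `L ≥ 3`: r05's statement and 40-line proof VERBATIM with
  the carriers swapped to the `…L0` twins and the producer swapped to ✓ `B8Prop3MultiLevelTorusP26L3.prop3_multiLevelTorus_V1_P26_vector_L3` (binder `(_ : 4 ≤ ℓ)` GONE);
  for every perturbation `A′` with the processed (1.34)∕(1.66) sizes `|(∂*∂A′)(b)| ≤ 2α₀(L^{j(b)}η)⁻³`, `|(Q_jA′)(c)| ≤ 2dLα₁(Lʲη)⁻¹`: (i) `∃! λ ∈ N(Q′)` with `R∂*(A′ − ∂λ) = 0`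
  (✓ `existsUnique_gauge212`); (ii) for every such `λ`, `A := A′ − ∂λ` has `QA = QA′`, `∂*∂A = ∂*∂A′` (✓ `data_of_restricted`) and the (1.36)∕(1.39)∕(1.62) members with
  `B₁ = 5dL·B₀′`.
* §2 ★★★ `linearLandau_of_adm22_allL` — THE H-LINE READING at the d = 3 carrier `F = ⟨ℓ+1, hL, m, hm⟩`, units `c′ = L^{K−n} = η⁻¹`: for every `Adm22` family `D : Domains (F.P K)`
  with `D.k = K − n` (unit cubes `Λ₀` allowed), every P2 weight family `w` (`IsLevWeight F n K D w`: `w m b = (L^{j(b)}η)^m`), every bond field `A′` with `w 3 b·|(∂*∂A′)(b)| ≤ 2α₀`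
  and `|(QA′)(i)| ≤ 6Lα₁·(L^{j(i)}η)⁻¹`: the unique restricted Landau correction exists, and `A := A′ − ∂λ` satisfies the (iii)-SHAPE ROWS **`w 1 b·|A(b)| ≤ B(α₀ + α₁)`**,
  **`w 2 b·|(DV ν c′ A)(b)| ≤ B(α₀ + α₁)`** (`DV ν c′` = `η⁻¹·(A(b + e_ν) − A(b))`, the gradient member of (iii)), `w 3 b·|(∂*∂A)(b)| ≤ B(α₀ + α₁)`, `w 3 b·|(ΔA)(b)| ≤ B(α₀ + α₁)`,
  with ONE constant `B = 15L·B₀′` and size thresholds `M_h ≥ M_h⁰`, `R ≥ R₀`, `a′ + 3 ≤ m + n` — the dictionary `(geomT D).len (blkV1 b)·|c′|⁻¹ = L^{j(b)}η = w 1 b`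
  (`weight_eq_len` from ✓ `FlatPortHRows12L0.len_blkV1_eq` + ✓ `FlatPortDistanceL0.levOf_domT`).
The correction `λ` IS `HalvingP1FlatCoreSlice.sliceCorr` of the sibling file `…LinearLandauSlice` (= `G′R∂*A′`, by `eq_sliceCorr`); this file is kept independent of it.
HONEST SCOPE: linear (abelian) chart at `U₀ = 1`, real scalar fibre (componentwise for `𝔰𝔲(2)` via the sibling `…LinearLandauSliceVec`); the Hölder member of (1.36) is not
part of the instance (r05's HONEST SCOPE (ii)); sizes existential in `(L, σ, α, band)`; small members (`a′ + 3 ≤ m + n`) only, the cover twin is the α6∕α7 pattern.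

References: T. Bałaban, Commun. Math. Phys. **99** (1985) 75–102 [Balaban1985RegularSpaces] (Thm 4 p.88, (1.67) p.88, Thm 2 p.83, (1.29) p.81, (1.36)–(1.38) p.82, (1.39) p.83,
Prop. 3 + (1.62) p.87, (1.55)–(1.56) p.86, (1.66) p.87; Prop. 6 (1.136)–(1.138) p.99); Commun. Math. Phys. **96** (1984) 223–250 [Balaban1984PropagatorsII] ((2.7) p.224, (2.12) p.225,
Prop. 2.6 (2.136) p.247); Commun. Math. Phys. **102** (1985) 277–309 [Balaban1985Variational] ((152)–(156) pp.301–302).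
-/

set_option autoImplicit false

noncomputable section

open scoped BigOperators InnerProductSpace

namespace Summit.QuantumFields.YangMills.Theorems.HalvingP1FlatCoreLinearLandau

open Literature.MathematicalPhysics.QuantumFieldTheory.Balaban1983to89
open Literature.MathematicalPhysics.QuantumFieldTheory.BalabanImbrieJaffe1984to88.BIJ85AxialPropagator411 (BondSpace)
open B6MultiLevelBoxOperator (N0)
open B6MultiLevelTorusOperatorL0 (TDomains)
open B6Geom246MultiLevelTorusL0 (geomT)
open B6GlobalChartV1 (PV toBox)
open B6GlobalChartV1L0 (blkV1 domT)
open B8Ineq192MultiLevelTorusL0 (lenT_pos)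
open B6SectADomainsV1 (Domains)
open B6SectAOperatorsV1 (dE dsE dcE dcsE QE QpE RE ScalarSpace BondIdx BondIdxSpace)
open B6SectACriticalPointV1 (existsUnique_gauge212)
open B6CubeWindowV1 (GlobalBand)
open B6GradLegKLevelV1 (DV)
open B8ScaledSupNorm (msup)
open LatticeFieldCalculus (laplace)
open B8Prop3MultiLevelTorusP26L3 (prop3_multiLevelTorus_V1_P26_vector_L3)
open B8Thm4MultiLevelTorus (data_of_restricted)
open B11Eq115Space (levOf)
open T3ContinuumYM3Torus (T3Family)
open FlatCubeOpsText (IsLevWeight Adm22)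
open FlatPortKernelRowsL0 (globalBand_unitWeights unitWeights_pos)
open FlatPortKernelRowsAllL (chart_params_allL)
open FlatPortHRows12 (cf_ne_zero)
open FlatPortHRows12L0 (len_blkV1_eq)
open FlatPortDistanceL0 (levOf_domT)

/-! ## §1 Theorem 4 at `U₀ = 1` on the level-0-admitting `k`-level V1 torus, every odd `L ≥ 3` -/

open Classical in
/-- ★★ **THEOREM 4 AT THE FLAT BACKGROUND `U₀ = 1` ON THE LEVEL-0-ADMITTING `k`-LEVEL V1 TORUS, EVERY ODD `L ≥ 3`** (p. 88 «There exists a constant c₁ such that for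
arbitrary U₀, U′U₀ satisfying (1.33), (1.34), (1.66) … there exists exactly one gauge transformation u satisfying (1.29) and such that the conditions (1.37), (1.38), (1.62) hold»):
r05's ✓ `thm4_multiLevelTorus_V1` VERBATIM on the carriers `B6MultiLevelTorusOperatorL0.TDomains` ∕ `B6GlobalChartV1L0.domT` (print's region `Λ₀ = T ∖ Ω₁` admitted) with the
floor `4 ≤ ℓ` DELETED (producer ✓ `prop3_multiLevelTorus_V1_P26_vector_L3`).  For the weight band `0 < b₀ ≤ b₁`: `∃ σ₀ > 0, ∀ σ ∈ (0, σ₀], α ∈ (0,1), ∃ B₀′ ≥ 1, M₄ > 0` such that on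
every admissible family (`k ≥ 1`, `M_h = Lᵃ ≥ 8`, `R ≥ 2L²`, `P′ ≥ 5L`, `M₄ ≤ L·M_h`; `c′ ≠ 0`, weights in the band), for every `A′` with `|(∂*∂A′)(b)| ≤ 2α₀(L^{j(b)}η)⁻³` and
`|(Q_jA′)(c)| ≤ 2dLα₁(Lʲη)⁻¹`: (i) `∃! λ ∈ N(Q′)`, `R∂*(A′ − ∂λ) = 0`; (ii) for every such `λ`, `A := A′ − ∂λ` satisfies (1.37) `QA = QA′`, `∂*∂A = ∂*∂A′`, and with `B₁ := 5dL·B₀′`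
the members `|A|₍₋₁₎, |∇A|₍₋₂₎, |ΔA|₍₋₃₎ ≤ B₁(α₀+α₁)`, `|∂*∂A|(b) ≤ B₁(α₀+α₁)(L^{j(b)}η)⁻³` and the three pointwise «on Ω_j» forms.
[cite: Balaban1985RegularSpaces, Thm 4 p.88, (1.67) p.88, (1.29) p.81, (1.36)–(1.38) p.82, (1.39) p.83, (1.62) + Prop. 3 p.87, (1.55)–(1.56) p.86, (1.66) p.87; Balaban1984PropagatorsII, (2.7) p.224, (2.12) p.225] -/
theorem thm4_multiLevelTorus_V1_L3 (d ℓ : ℕ) (hd : 1 ≤ d + 1) (hL : Odd (ℓ + 1) ∧ 1 < ℓ + 1) {b₀ b₁ : ℝ} (hb₀ : 0 < b₀) (hb₁ : b₀ ≤ b₁) :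
    ∃ σ₀ : ℝ, 0 < σ₀ ∧ ∀ (σ : ℝ), 0 < σ → σ ≤ σ₀ → ∀ (α : ℝ), 0 < α → α < 1 →
    ∃ B₀' M₄ : ℝ, 1 ≤ B₀' ∧ 0 < M₄ ∧
    ∀ (m K : ℕ) {Mh k R : ℕ} {P' : Fin (d + 1) → ℕ}
      (hN : ∀ μ, N0 ℓ Mh k P' μ = (PV d ℓ m K hd hL).sitesPerDir 0) (D : TDomains d ℓ Mh k P' R) (hk : k ≤ m + K) (_ : 1 ≤ k)
      {a : ℕ} (_ : Mh = (ℓ + 1) ^ a) (_ : 8 ≤ Mh) (_ : 2 * (ℓ + 1) ^ 2 ≤ R) (_ : ∀ μ, 5 * (ℓ + 1) ≤ P' μ)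
      (_ : M₄ ≤ ((ℓ : ℝ) + 1) * Mh)
      {cf : ℝ} (_ : cf ≠ 0) {w : BondIdx (domT hN D hk) → ℝ} (_ : ∀ i, 0 < w i) (_ : GlobalBand b₀ b₁ cf w),
      ∀ (A' : BondSpace (PV d ℓ m K hd hL)) (α₀ α₁ : ℝ), 0 ≤ α₀ → 0 ≤ α₁ →
        (∀ b, |dcsE cf (dcE cf A') b| ≤ 2 * α₀ * (((geomT D).len (blkV1 hN D b) * |cf|⁻¹) ^ 3)⁻¹) →
        (∀ i, |QE (domT hN D hk) A' i| ≤ 2 * ((d : ℝ) + 1) * ((ℓ : ℝ) + 1) * α₁ * (((ℓ : ℝ) + 1) ^ (i.1.1 : ℕ) * |cf|⁻¹)⁻¹) →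
        (∃! n : ScalarSpace (PV d ℓ m K hd hL),
            n ∈ LinearMap.ker (QpE (domT hN D hk)) ∧ RE (domT hN D hk) cf (dsE cf (A' - dE cf n)) = 0) ∧
        ∀ n : ScalarSpace (PV d ℓ m K hd hL), n ∈ LinearMap.ker (QpE (domT hN D hk)) →
          RE (domT hN D hk) cf (dsE cf (A' - dE cf n)) = 0 →
          QE (domT hN D hk) (A' - dE cf n) = QE (domT hN D hk) A' ∧
          dcsE cf (dcE cf (A' - dE cf n)) = dcsE cf (dcE cf A') ∧
          msup (ℓ + 1) k |cf|⁻¹ (-1) (fun j (b : PBond (PV d ℓ m K hd hL) 0) => j ≤ (blkV1 hN D b).1.1) (WithLp.ofLp (A' - dE cf n)) ≤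
              5 * ((d : ℝ) + 1) * ((ℓ : ℝ) + 1) * B₀' * (α₀ + α₁) ∧
          msup (ℓ + 1) k |cf|⁻¹ (-2) (fun j (p : Fin (d + 1) × PBond (PV d ℓ m K hd hL) 0) => j ≤ (blkV1 hN D p.2).1.1)
              (fun p : Fin (d + 1) × PBond (PV d ℓ m K hd hL) 0 => DV (P := PV d ℓ m K hd hL) p.1 cf (WithLp.ofLp (A' - dE cf n)) p.2) ≤
              5 * ((d : ℝ) + 1) * ((ℓ : ℝ) + 1) * B₀' * (α₀ + α₁) ∧
          (∀ b : PBond (PV d ℓ m K hd hL) 0,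
              |dcsE cf (dcE cf (A' - dE cf n)) b| ≤ 5 * ((d : ℝ) + 1) * ((ℓ : ℝ) + 1) * B₀' * (α₀ + α₁) *
                (((geomT D).len (blkV1 hN D b) * |cf|⁻¹) ^ 3)⁻¹) ∧
          msup (ℓ + 1) k |cf|⁻¹ (-3) (fun j (b : PBond (PV d ℓ m K hd hL) 0) => j ≤ (blkV1 hN D b).1.1)
              (fun b : PBond (PV d ℓ m K hd hL) 0 => laplace cf (fun z => (A' - dE cf n) ⟨z, b.dir⟩) b.src) ≤
              5 * ((d : ℝ) + 1) * ((ℓ : ℝ) + 1) * B₀' * (α₀ + α₁) ∧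
          (∀ b : PBond (PV d ℓ m K hd hL) 0,
              |WithLp.ofLp (A' - dE cf n) b| ≤ 5 * ((d : ℝ) + 1) * ((ℓ : ℝ) + 1) * B₀' * (α₀ + α₁) *
                (((geomT D).len (blkV1 hN D b) * |cf|⁻¹) ^ 1)⁻¹) ∧
          (∀ (ν : Fin (d + 1)) (b : PBond (PV d ℓ m K hd hL) 0),
              |DV (P := PV d ℓ m K hd hL) ν cf (WithLp.ofLp (A' - dE cf n)) b| ≤ 5 * ((d : ℝ) + 1) * ((ℓ : ℝ) + 1) * B₀' * (α₀ + α₁) *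
                (((geomT D).len (blkV1 hN D b) * |cf|⁻¹) ^ 2)⁻¹) ∧
          (∀ b : PBond (PV d ℓ m K hd hL) 0,
              |laplace cf (fun z => (A' - dE cf n) ⟨z, b.dir⟩) b.src| ≤ 5 * ((d : ℝ) + 1) * ((ℓ : ℝ) + 1) * B₀' * (α₀ + α₁) *
                (((geomT D).len (blkV1 hN D b) * |cf|⁻¹) ^ 3)⁻¹) := by
  -- Proposition 3 at `U₀ = 1` on the level-0-admitting `k`-level V1 torus, every odd `L ≥ 3`, no [B6]-side hypothesis (ym-inputs-p06 g2's `_L3`)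
  obtain ⟨σ₀, hσ₀, h3⟩ := prop3_multiLevelTorus_V1_P26_vector_L3 d ℓ hd hL hb₀ hb₁
  refine ⟨σ₀, hσ₀, fun σ hσ hσle α hα0 hα1 => ?_⟩
  obtain ⟨B₀, KL, hB₀, hKL, Amaj, M₄, hA, hM₄, hP3⟩ := h3 σ hσ hσle α hα0 hα1
  -- Prop. 3's constant «B₀» at `U₀ = 1`: `B₀′ = K_L(B₀A + 1)(1 + 2b₁) ≥ 1`
  have hb₁0 : 0 ≤ b₁ := hb₀.le.trans hb₁
  have hB₀' : (1 : ℝ) ≤ KL * ((B₀ * Amaj + 1) * (1 + 2 * b₁)) := by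
    have h1 : (1 : ℝ) ≤ B₀ * Amaj + 1 := le_add_of_nonneg_left (mul_nonneg (zero_le_one.trans hB₀) hA)
    have h2 : (1 : ℝ) ≤ 1 + 2 * b₁ := le_add_of_nonneg_right (by positivity)
    exact one_le_mul_of_one_le_of_one_le hKL (one_le_mul_of_one_le_of_one_le h1 h2)
  refine ⟨KL * ((B₀ * Amaj + 1) * (1 + 2 * b₁)), M₄, hB₀', hM₄, ?_⟩
  intro m K Mh k R P' hN D hk hk1 a hMha hM8 hR2 hP hM4t cf hcf w hw hwb A' α₀ α₁ hα₀ hα₁ hJ hB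
  refine ⟨existsUnique_gauge212 (domT hN D hk) hcf A', fun n hn hLan => ?_⟩
  -- the construction's data: (1.37) `QA = QA′` and `J = ∂*∂A = ∂*∂A′`
  obtain ⟨h37, h55⟩ := data_of_restricted (domT hN D hk) cf A' hn
  have hdP : (0 : ℝ) ≤ (d : ℝ) + 1 := by positivity
  have hdL : (1 : ℝ) ≤ ((d : ℝ) + 1) * ((ℓ : ℝ) + 1) :=
    one_le_mul_of_one_le_of_one_le (le_add_of_nonneg_left (Nat.cast_nonneg d)) (le_add_of_nonneg_left (Nat.cast_nonneg ℓ))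
  -- Proposition 3 fed with `J := ∂*∂A′`, the Landau clause, `B := QA′`, `n_J = 2α₀`, `n_B = 2dLα₁`, `α₂ = C₂ = 0`
  have h := hP3 m K hN D hk hk1 hMha hM8 hR2 hP hM4t hcf hw hwb (A' - dE cf n) (dcsE cf (dcE cf A'))
    (QE (domT hN D hk) A') h55 hLan h37 (2 * α₀) (2 * ((d : ℝ) + 1) * ((ℓ : ℝ) + 1) * α₁) (by positivity) (by positivity) hJ hB
    ((d : ℝ) + 1) ((ℓ : ℝ) + 1) 0 α₀ α₁ 0 hdP hdL hα₀ hα₁ le_rfl (le_of_eq (by ring)) (le_of_eq (by ring)) (by norm_num) (by norm_num)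
    (by norm_num; exact add_nonneg hα₀ hα₁)
  obtain ⟨hA1, hA2, hJ3, hA4, hp1, hp2, hp3⟩ := h
  refine ⟨h37, h55, hA1, hA2, fun b => ?_, hA4, hp1, hp2, hp3⟩
  -- (1.39)∕(1.62) for `D*DA = J`: `|J(b)| ≤ 2α₀·w₃(b) ≤ B₁(α₀ + α₁)·w₃(b)`
  have hw3 : (0 : ℝ) ≤ (((geomT D).len (blkV1 hN D b) * |cf|⁻¹) ^ 3)⁻¹ :=
    inv_nonneg.2 (pow_nonneg (mul_nonneg (lenT_pos D _).le (inv_nonneg.2 (abs_nonneg cf))) 3)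
  rw [h55]
  exact (hJ b).trans (mul_le_mul_of_nonneg_right hJ3 hw3)

/-! ## §2 The H-line reading: `Adm22` families of the d = 3 carrier, `IsLevWeight` rows, every odd `L ≥ 3` -/

/-- `1 ≤ 2 + 1` (the d = 3 carrier's dimension hypothesis). [folklore] -/
private theorem hd3 : 1 ≤ 2 + 1 := by norm_num

/-- **THE WEIGHT DICTIONARY**: at a charted family `domT hN D hk` of the d = 3 carrier with units `c′ = L^{K−n}`, the P2 text's level weight IS the lineage's block length
in units of `η`: `w m b = ((geomT D).len (blkV1 b)·|c′|⁻¹)^m = (L^{j(b)}η)^m`. [cite: Balaban1984PropagatorsII, (2.46) p.231; Balaban1985Variational, (115) p.294] -/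
theorem weight_eq_len (ℓ : ℕ) (hL : Odd (ℓ + 1) ∧ 1 < ℓ + 1) (m : ℕ) (hm : 1 ≤ m) (n K : ℕ) {Mh R : ℕ} {P' : Fin (2 + 1) → ℕ}
    (hN : ∀ μ, N0 ℓ Mh (K - n) P' μ = (PV 2 ℓ m K hd3 hL).sitesPerDir 0) (D : TDomains 2 ℓ Mh (K - n) P' R) (hk : K - n ≤ m + K)
    {w : ℕ → PBond (PV 2 ℓ m K hd3 hL) 0 → ℝ} (hw : IsLevWeight (⟨ℓ + 1, hL, m, hm⟩ : T3Family) n K (domT hN D hk) w)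
    (j : ℕ) (b : PBond (PV 2 ℓ m K hd3 hL) 0) :
    w j b = ((geomT D).len (blkV1 hN D b) * |(((ℓ + 1 : ℕ) : ℝ)) ^ (K - n)|⁻¹) ^ j := by
  rw [hw j b, len_blkV1_eq ℓ hL m n K hN D b]
  have hlev := levOf_domT (hd := hd3) hN D hk b.src
  have hL0 : (0 : ℝ) < ((ℓ + 1 : ℕ) : ℝ) := by exact_mod_cast Nat.succ_pos ℓ
  congr 1
  show ((((⟨ℓ + 1, hL, m, hm⟩ : T3Family).L : ℕ) : ℝ)) ^ levOf (fun j => {x : Site (PV 2 ℓ m K hd3 hL) 0 | (domT hN D hk).InOm j x}) (K - n) b.src *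
      (((((⟨ℓ + 1, hL, m, hm⟩ : T3Family).L : ℕ) : ℝ))⁻¹) ^ (K - n) = _
  rw [hlev, abs_of_pos (pow_pos hL0 _), inv_pow]

/-- A pointwise «on Ω_j» bound `|X| ≤ B·((len·|c′|⁻¹)^j)⁻¹` IS the weighted row `w j b·|X| ≤ B`. [cite: Balaban1985RegularSpaces, (1.36) p.82, (1.62) p.87] -/
theorem row_of_pointwise (ℓ : ℕ) (hL : Odd (ℓ + 1) ∧ 1 < ℓ + 1) (m : ℕ) (hm : 1 ≤ m) (n K : ℕ) {Mh R : ℕ} {P' : Fin (2 + 1) → ℕ}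
    (hN : ∀ μ, N0 ℓ Mh (K - n) P' μ = (PV 2 ℓ m K hd3 hL).sitesPerDir 0) (D : TDomains 2 ℓ Mh (K - n) P' R) (hk : K - n ≤ m + K)
    {w : ℕ → PBond (PV 2 ℓ m K hd3 hL) 0 → ℝ} (hw : IsLevWeight (⟨ℓ + 1, hL, m, hm⟩ : T3Family) n K (domT hN D hk) w)
    (j : ℕ) (b : PBond (PV 2 ℓ m K hd3 hL) 0) {X B : ℝ}
    (h : |X| ≤ B * (((geomT D).len (blkV1 hN D b) * |(((ℓ + 1 : ℕ) : ℝ)) ^ (K - n)|⁻¹) ^ j)⁻¹) : w j b * |X| ≤ B := by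
  have hpos : 0 < ((geomT D).len (blkV1 hN D b) * |(((ℓ + 1 : ℕ) : ℝ)) ^ (K - n)|⁻¹) ^ j :=
    pow_pos (mul_pos (lenT_pos D _) (inv_pos.2 (abs_pos.2 (cf_ne_zero ℓ n K)))) j
  rw [weight_eq_len ℓ hL m hm n K hN D hk hw j b]
  calc _ ≤ ((geomT D).len (blkV1 hN D b) * |(((ℓ + 1 : ℕ) : ℝ)) ^ (K - n)|⁻¹) ^ j *
        (B * (((geomT D).len (blkV1 hN D b) * |(((ℓ + 1 : ℕ) : ℝ)) ^ (K - n)|⁻¹) ^ j)⁻¹) := mul_le_mul_of_nonneg_left h hpos.le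
    _ = B := by rw [mul_left_comm, mul_inv_cancel₀ hpos.ne', mul_one]

/-- The converse direction, for the hypothesis side: `w j b·|X| ≤ B` gives `|X| ≤ B·((len·|c′|⁻¹)^j)⁻¹`. [cite: Balaban1985RegularSpaces, (1.55) p.86] -/
theorem pointwise_of_row (ℓ : ℕ) (hL : Odd (ℓ + 1) ∧ 1 < ℓ + 1) (m : ℕ) (hm : 1 ≤ m) (n K : ℕ) {Mh R : ℕ} {P' : Fin (2 + 1) → ℕ}
    (hN : ∀ μ, N0 ℓ Mh (K - n) P' μ = (PV 2 ℓ m K hd3 hL).sitesPerDir 0) (D : TDomains 2 ℓ Mh (K - n) P' R) (hk : K - n ≤ m + K)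
    {w : ℕ → PBond (PV 2 ℓ m K hd3 hL) 0 → ℝ} (hw : IsLevWeight (⟨ℓ + 1, hL, m, hm⟩ : T3Family) n K (domT hN D hk) w)
    (j : ℕ) (b : PBond (PV 2 ℓ m K hd3 hL) 0) {X B : ℝ} (h : w j b * |X| ≤ B) :
    |X| ≤ B * (((geomT D).len (blkV1 hN D b) * |(((ℓ + 1 : ℕ) : ℝ)) ^ (K - n)|⁻¹) ^ j)⁻¹ := by
  have hpos : 0 < ((geomT D).len (blkV1 hN D b) * |(((ℓ + 1 : ℕ) : ℝ)) ^ (K - n)|⁻¹) ^ j :=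
    pow_pos (mul_pos (lenT_pos D _) (inv_pos.2 (abs_pos.2 (cf_ne_zero ℓ n K)))) j
  rw [weight_eq_len ℓ hL m hm n K hN D hk hw j b] at h
  rw [← div_eq_mul_inv, le_div_iff₀ hpos, mul_comm]
  exact h

open Classical in
/-- ★★★ **THE LINEAR LANDAU PROBLEM ON THE H-LINE's `Adm22` FAMILIES, EVERY ODD `L ≥ 3`, IN `IsLevWeight` LETTERS** (LEAD-H RULING L-2 (3): the J4c solver's linear core +
`core`'s (iii) gradient member at the fixed point).  d = 3 carrier `F = ⟨ℓ+1, hL, m, hm⟩` (`F.P K ≡ PV 2 ℓ m K`), units `c′ := L^{K−n}`: there are thresholds `M_h⁰, R₀` and ONE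
constant `B ≥ 1` such that for every `m ≥ 1`, heights `1 ≤ K − n`, `K − n + 1 ≤ m + K`, `M_h = L^{a′} ≥ M_h⁰`, `R ≥ R₀`, small members `a′ + 3 ≤ m + n`, every
`D : Domains (F.P K)` with `D.k = K − n` and `Adm22 D R (L·M_h)` (unit cubes `Λ₀` allowed), every P2 weight family `w` (`IsLevWeight F n K D w`), every bond field `A′` and
`α₀, α₁ ≥ 0` with the curl-curl row `w 3 b·|(∂*∂A′)(b)| ≤ 2α₀` and the average row `|(QA′)(i)| ≤ 6Lα₁·(L^{j(i)}·c′⁻¹)⁻¹` on the index bonds: (i) `∃! λ ∈ ker Q′` with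
`R∂*(A′ − ∂λ) = 0`; (ii) for every such `λ`, `A := A′ − ∂λ` has `QA = QA′`, `∂*∂A = ∂*∂A′` and the rows `w 1 b·|A(b)| ≤ B(α₀+α₁)`, `w 2 b·|(DV ν c′ A)(b)| ≤ B(α₀+α₁)`,
`w 3 b·|(∂*∂A)(b)| ≤ B(α₀+α₁)`, `w 3 b·|(ΔA)(b)| ≤ B(α₀+α₁)`. [cite: Balaban1985RegularSpaces, Thm 4 p.88, Prop. 3 + (1.62) p.87, Prop. 6 (1.136)–(1.138) p.99; Balaban1985Variational, (152) p.301] -/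
theorem linearLandau_of_adm22_allL (ℓ : ℕ) (hL : Odd (ℓ + 1) ∧ 1 < ℓ + 1) :
    ∃ (Mh₀ R₀ : ℕ) (B : ℝ), 1 ≤ B ∧
    ∀ (m : ℕ) (hm : 1 ≤ m) (n K : ℕ) (_ : 1 ≤ K - n) (_ : K - n + 1 ≤ m + K) {Mh R a' : ℕ} (_ : Mh = (ℓ + 1) ^ a') (_ : Mh₀ ≤ Mh) (_ : R₀ ≤ R)
      (_ : a' + 3 ≤ m + n) (D : Domains (PV 2 ℓ m K hd3 hL)) (hDk : D.k = K - n) (_ : Adm22 D R ((ℓ + 1) * Mh))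
      (w : ℕ → PBond (PV 2 ℓ m K hd3 hL) 0 → ℝ) (_ : IsLevWeight (⟨ℓ + 1, hL, m, hm⟩ : T3Family) n K D w)
      (A' : BondSpace (PV 2 ℓ m K hd3 hL)) (α₀ α₁ : ℝ), 0 ≤ α₀ → 0 ≤ α₁ →
        (∀ b, w 3 b * |dcsE ((((ℓ + 1 : ℕ) : ℝ)) ^ (K - n)) (dcE ((((ℓ + 1 : ℕ) : ℝ)) ^ (K - n)) A') b| ≤ 2 * α₀) →
        (∀ i : BondIdx D, |QE D A' i| ≤ 2 * ((2 : ℝ) + 1) * ((ℓ : ℝ) + 1) * α₁ *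
          (((ℓ : ℝ) + 1) ^ (i.1.1 : ℕ) * |(((ℓ + 1 : ℕ) : ℝ)) ^ (K - n)|⁻¹)⁻¹) →
        (∃! lam : ScalarSpace (PV 2 ℓ m K hd3 hL),
            lam ∈ LinearMap.ker (QpE D) ∧
              RE D ((((ℓ + 1 : ℕ) : ℝ)) ^ (K - n)) (dsE ((((ℓ + 1 : ℕ) : ℝ)) ^ (K - n)) (A' - dE ((((ℓ + 1 : ℕ) : ℝ)) ^ (K - n)) lam)) = 0) ∧
        ∀ lam : ScalarSpace (PV 2 ℓ m K hd3 hL), lam ∈ LinearMap.ker (QpE D) →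
          RE D ((((ℓ + 1 : ℕ) : ℝ)) ^ (K - n)) (dsE ((((ℓ + 1 : ℕ) : ℝ)) ^ (K - n)) (A' - dE ((((ℓ + 1 : ℕ) : ℝ)) ^ (K - n)) lam)) = 0 →
          QE D (A' - dE ((((ℓ + 1 : ℕ) : ℝ)) ^ (K - n)) lam) = QE D A' ∧
          dcsE ((((ℓ + 1 : ℕ) : ℝ)) ^ (K - n)) (dcE ((((ℓ + 1 : ℕ) : ℝ)) ^ (K - n)) (A' - dE ((((ℓ + 1 : ℕ) : ℝ)) ^ (K - n)) lam)) =
            dcsE ((((ℓ + 1 : ℕ) : ℝ)) ^ (K - n)) (dcE ((((ℓ + 1 : ℕ) : ℝ)) ^ (K - n)) A') ∧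
          (∀ b, w 1 b * |WithLp.ofLp (A' - dE ((((ℓ + 1 : ℕ) : ℝ)) ^ (K - n)) lam) b| ≤ B * (α₀ + α₁)) ∧
          (∀ (ν : Fin (2 + 1)) b, w 2 b * |DV (P := PV 2 ℓ m K hd3 hL) ν ((((ℓ + 1 : ℕ) : ℝ)) ^ (K - n))
              (WithLp.ofLp (A' - dE ((((ℓ + 1 : ℕ) : ℝ)) ^ (K - n)) lam)) b| ≤ B * (α₀ + α₁)) ∧
          (∀ b, w 3 b * |dcsE ((((ℓ + 1 : ℕ) : ℝ)) ^ (K - n)) (dcE ((((ℓ + 1 : ℕ) : ℝ)) ^ (K - n))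
              (A' - dE ((((ℓ + 1 : ℕ) : ℝ)) ^ (K - n)) lam)) b| ≤ B * (α₀ + α₁)) ∧
          (∀ b, w 3 b * |laplace ((((ℓ + 1 : ℕ) : ℝ)) ^ (K - n)) (fun z => (A' - dE ((((ℓ + 1 : ℕ) : ℝ)) ^ (K - n)) lam) ⟨z, b.dir⟩) b.src| ≤
              B * (α₀ + α₁)) := by
  -- Theorem 4♭ at the unit band `b₀ = b₁ = 1`, rate `σ₀`, budget `α = 1/2`
  obtain ⟨σ₀, hσ₀, h4⟩ := thm4_multiLevelTorus_V1_L3 2 ℓ hd3 hL one_pos (le_refl (1 : ℝ))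
  obtain ⟨B₀', M₄, hB₀', hM₄, hmain⟩ := h4 σ₀ hσ₀ le_rfl (1 / 2) (by norm_num) (by norm_num)
  -- thresholds: `M_h ≥ max 8 ⌈M₄⌉₊` (so `8 ≤ M_h` and `M₄ ≤ M_h ≤ L·M_h`), `R ≥ 2L²`; the constant `B := 5·3·L·B₀′`
  have hL1 : (1 : ℝ) ≤ (ℓ : ℝ) + 1 := le_add_of_nonneg_left (Nat.cast_nonneg ℓ)
  refine ⟨max 8 ⌈M₄⌉₊, 2 * (ℓ + 1) ^ 2, 5 * ((2 : ℝ) + 1) * ((ℓ : ℝ) + 1) * B₀', ?_, ?_⟩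
  · calc (1 : ℝ) ≤ 5 * (((2 : ℝ) + 1) * ((ℓ : ℝ) + 1)) * 1 := by nlinarith
      _ ≤ 5 * (((2 : ℝ) + 1) * ((ℓ : ℝ) + 1)) * B₀' := mul_le_mul_of_nonneg_left hB₀' (by positivity)
      _ = 5 * ((2 : ℝ) + 1) * ((ℓ : ℝ) + 1) * B₀' := by ring
  intro m hm n K hk1 hk' Mh R a' hMha hMh hR hsize D hDk hAdm w hw A' α₀ α₁ hα₀ hα₁ hJ hB
  have hk : K - n ≤ m + K := by omega
  obtain ⟨hN, hLP, hP5⟩ := chart_params_allL ℓ m n K a' hL hk1 hsize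
  have hN' : ∀ μ : Fin (2 + 1), N0 ℓ Mh (K - n) (fun _ => 2 * (ℓ + 1) ^ (m + n - 1 - a')) μ = (PV 2 ℓ m K hd3 hL).sitesPerDir 0 := by
    rw [hMha]; exact hN
  -- realise `D` as the charted family of a level-0-admitting torus family `D′`
  set D' := FlatPortChartL0.tdOfAdmL0 hN' D hDk hk hAdm with hD'
  have hEq : domT hN' D' hk = D := FlatPortChartL0.domT_tdOfAdmL0 hN' D hDk hk hAdm
  rw [← hEq] at hw hB ⊢
  -- the admissibility lines of Theorem 4♭
  have hM8 : 8 ≤ Mh := le_trans (le_max_left _ _) hMh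
  have hM4t : M₄ ≤ ((ℓ : ℝ) + 1) * Mh := by
    have h1 : M₄ ≤ (⌈M₄⌉₊ : ℝ) := Nat.le_ceil _
    have h2 : (⌈M₄⌉₊ : ℝ) ≤ (Mh : ℝ) := by exact_mod_cast le_trans (le_max_right _ _) hMh
    have h3 : (Mh : ℝ) ≤ ((ℓ : ℝ) + 1) * Mh := le_mul_of_one_le_left (Nat.cast_nonneg _) hL1
    linarith
  have hP5L : ∀ μ, 5 * (ℓ + 1) ≤ (fun _ : Fin (2 + 1) => 2 * (ℓ + 1) ^ (m + n - 1 - a')) μ := fun μ => by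
    rw [hLP μ, mul_comm]; exact Nat.mul_le_mul_left _ (hP5 μ)
  -- the band weights of the port (unit band, units `c′ = L^{K−n}`)
  set ws : BondIdx (domT hN' D' hk) → ℝ := fun i =>
    ((((ℓ + 1 : ℕ) : ℝ)) ^ (K - n) / (((ℓ + 1 : ℕ) : ℝ)) ^ (i.1.1 : ℕ)) ^ 2 * ((((ℓ + 1 : ℕ) : ℝ)) ^ (i.1.1 : ℕ)) ^ (2 + 1) with hws_def
  have hws : ∀ i, 0 < ws i := unitWeights_pos ℓ hL m n K hN' D' hk
  have hband : GlobalBand (Dm := domT hN' D' hk) 1 1 ((((ℓ + 1 : ℕ) : ℝ)) ^ (K - n)) ws := globalBand_unitWeights ℓ hL m n K hN' D' hk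
  -- the curl-curl row read pointwise
  have hJ' : ∀ b, |dcsE ((((ℓ + 1 : ℕ) : ℝ)) ^ (K - n)) (dcE ((((ℓ + 1 : ℕ) : ℝ)) ^ (K - n)) A') b| ≤
      2 * α₀ * (((geomT D').len (blkV1 hN' D' b) * |(((ℓ + 1 : ℕ) : ℝ)) ^ (K - n)|⁻¹) ^ 3)⁻¹ :=
    fun b => pointwise_of_row ℓ hL m hm n K hN' D' hk hw 3 b (hJ b)
  have hB'' : ∀ i : BondIdx (domT hN' D' hk), |QE (domT hN' D' hk) A' i| ≤ 2 * ((2 : ℝ) + 1) * ((ℓ : ℝ) + 1) * α₁ *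
      (((ℓ : ℝ) + 1) ^ (i.1.1 : ℕ) * |(((ℓ + 1 : ℕ) : ℝ)) ^ (K - n)|⁻¹)⁻¹ := hB
  obtain ⟨huniq, hall⟩ := hmain m K hN' D' hk hk1 hMha hM8 hR hP5L hM4t (cf_ne_zero ℓ n K) hws hband A' α₀ α₁ hα₀ hα₁ hJ' hB''
  refine ⟨huniq, fun lam hlam hLan => ?_⟩
  obtain ⟨h37, h55, -, -, hJ3, -, hp1, hp2, hp3⟩ := hall lam hlam hLan
  refine ⟨h37, h55, fun b => ?_, fun ν b => ?_, fun b => ?_, fun b => ?_⟩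
  · exact row_of_pointwise ℓ hL m hm n K hN' D' hk hw 1 b (hp1 b)
  · exact row_of_pointwise ℓ hL m hm n K hN' D' hk hw 2 b (hp2 ν b)
  · exact row_of_pointwise ℓ hL m hm n K hN' D' hk hw 3 b (hJ3 b)
  · exact row_of_pointwise ℓ hL m hm n K hN' D' hk hw 3 b (hp3 b)

end Summit.QuantumFields.YangMills.Theorems.HalvingP1FlatCoreLinearLandau

end
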